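import Summits.BirchSwinnertonDyer.Rank1Residual.GaloisImage.HauptmodulDeltaUnitValuation
import HarnessLib

/-!
# The level-`9` Hauptmodul at `v₃(j) = 3k + 4 ≥ 10`, `j/3^{v₃(j)} ≡ ε − 3e₁ (mod 9)` is
# VALUATION-FORCED after the unit normalisation:
# `v((3^{2k+2}θ/(2(θ³ − 24)(e₁(θ³ − 24) + 3^{k+1})))² − 1)⁹ = v(3)⁴`
# (cell `b2b-bsdres`, team n1011, seat p02 gen 6 — row T-b11-F4, file F4c-H18 'Hauptmodul route,
# curve-free core at v₃(j) ≡ 1 (mod 3), v₃(j) ≥ 10'; pure valuation algebra in `ℚ̄`)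

HONEST FRAMING (cell `b2b-bsdres`, run/shared/lean/b2b/bsd-rank1-residual/, verbatim in every
file): the goal of the cell is to DELETE the COMBINATION-SHAPED residual classes of the
Birch–Swinnerton-Dyer formula for ALL analytic-rank `≤ 1` elliptic curves over `ℚ` — "full BSD
formula for every rank `≤ 1` curve in class `C`" assembled STRICTLY from published theorems — so
that the rank-`≤ 1` remainder becomes exactly the CONSTRUCTION-SHAPED classes, which are TYPED
(missing-input `Prop`s), NOT attempted. This is not "finishing BSD". Team n1011 (N10 / N11):
research route; no claim beyond the stated classes; labels UNCHANGED; nothing is booked. Theorems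
only (no definition, no named fact).

## What this file proves

`v` the place of `ℚ̄` over `3`, `t = v(3)`, `q = 3^k`; `K = j/3^{3k+4}` (a `3`-adic unit),
`S = θ³ = 3(δ + 8)` the level-`3` Hauptmodul at a NON-canonical `3`-torsion group (`v(S) = t`), so
that `δ³(δ + 8) = 3q³K(δ − 1)` and `v(δ)³ = t^{3k+1}` (`HauptmodulDeltaUnitValuation`).

* `valuation_numerator_vone` (§1) — `k ≥ 2`, `ε, e₁ = ±1`, `v(K − (ε − 3e₁)) ≤ t²`:
  `v(εq³(δ + 8)² − 8K(δ − 1)(q + e₁δ)³) = t^{2k+1}·v(δ)`.  After multiplying by `δ + 8` and using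
  the quartic once, `N(δ + 8) = −24e₁Kq²δ(δ − 1)(δ + 8) + q³[εδ³ + c₂δ² + c₁δ + c₀] −
  24Kqδ²(δ − 1)(δ + 8)` with `c₀ = 512ε + 64K − 24e₁K² = 9(80ε − 48e₁) + D(208 − 48εe₁ − 24e₁D)`,
  `D = K − ε + 3e₁`; the first term dominates (this is where `k ≥ 2` enters: `q³c₁δ` has
  `t^{3k}v(δ) < t^{2k+1}v(δ)`).
* **`valuation_hauptmodul_nine_invariant_vone_pow_nine`** (§2) — `k ≥ 2`, `ε, e₁ = ±1`,
  `9 ∣ num(j/3^{3k+4} − (ε − 3e₁))`, `j(S − 27) = S(S − 24)³`, `v(S) = t`, `θ³ = S` ⟹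
  **`v((3^{2k+2}θ/(2(θ³ − 24)(e₁(θ³ − 24) + 3^{k+1})))² − 1)⁹ = t⁴`** — valuation exactly `4/9`.

MECHANISM: `Y = qθ/(2δ)` has `Y³ = (δ + 8)²/(8K(δ − 1))` EXACTLY (a unit `≡ K⁻¹ ≢ ±1 (mod 9)`);
dividing by the one-unit `1 + e₁δ/q` (`δ/q` a uniformiser of the cubic field `ℚ₃(δ)`) kills the
digits of order `1`: `X = εY/(1 + e₁δ/q)` has `ord(X³ − 1) = 4/3 < 3/2`, so `ord(X − 1) = 4/9`
(cube-root lemma) and `z = X² − 1` is sign-free.  The residues `K mod 9 ∈ {7, 4, 5, 2}` correspond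
to `(ε, e₁) = (1,1), (1,−1), (−1,1), (−1,−1)`; `K ≡ ±1 (mod 9)` has `e = 3` (no invariant of a
cyclic `9`-group can work, kit j135556).  Assembly with the curve side in `HauptmodulNineTowerVOne`
(32 census cells at `v₃(j) ∈ {10, 13, 16, 19}`; EVIDENCE kit j135897, 32/32).  Nothing booked.

References: [Maier2006] Table 4 (N = 3, 9), §5.
-/

noncomputable section

set_option maxRecDepth 10000

open scoped Classical

namespace Summit.BirchSwinnertonDyer.Rank1Residual.GaloisImage

open Literature.NumberTheory.EllipticCurves Literature.NumberTheory.GaloisRepresentations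
  Rat.HeightOneSpectrum

/-! ### §1 The numerator at `v₃(j) = 3k + 4`, `k ≥ 2` -/

/-- **`v(εq³(δ + 8)² − 8K(δ − 1)(q + e₁δ)³) = v(3)^{2k+1}·v(δ)`** (`q = 3^k`, `k ≥ 2`,
`ε, e₁ = ±1`, `v(K − (ε − 3e₁)) ≤ v(3)²`, `v(K) = v(δ + 8) = 1`, `δ³(δ + 8) = 3q³K(δ − 1)`,
`v(δ)³ = v(3)^{3k+1}`).  See the module docstring for the identity behind it. [folklore] -/
theorem valuation_numerator_vone {δ K ε e₁ : AlgebraicClosure ℚ} {k : ℕ} (hk : 2 ≤ k)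
    (hε : ε = 1 ∨ ε = -1) (he : e₁ = 1 ∨ e₁ = -1)
    (hKε : (placeOver 3).valuation (K - (ε - 3 * e₁)) ≤
      (placeOver 3).valuation (3 : AlgebraicClosure ℚ) ^ 2)
    (hK : (placeOver 3).valuation K = 1)
    (h8 : (placeOver 3).valuation (δ + 8) = 1)
    (hR : δ ^ 3 * (δ + 8) = 3 * ((3 : AlgebraicClosure ℚ) ^ k) ^ 3 * K * (δ - 1))
    (hδ : (placeOver 3).valuation δ ^ 3 = (placeOver 3).valuation (3 : AlgebraicClosure ℚ) ^ (3 * k + 1)) :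
    (placeOver 3).valuation (ε * ((3 : AlgebraicClosure ℚ) ^ k) ^ 3 * (δ + 8) ^ 2 -
        8 * K * (δ - 1) * ((3 : AlgebraicClosure ℚ) ^ k + e₁ * δ) ^ 3) =
      (placeOver 3).valuation (3 : AlgebraicClosure ℚ) ^ (2 * k + 1) * (placeOver 3).valuation δ := by
  set v := (placeOver 3).valuation with hv
  set t := v (3 : AlgebraicClosure ℚ) with ht
  set s := v δ with hs
  set q : AlgebraicClosure ℚ := (3 : AlgebraicClosure ℚ) ^ k with hq
  have ht1 : t < 1 := valuation_three_lt_one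
  have ht0 : t ≠ 0 := valuation_three_ne_zero
  have ht0' : 0 < t := zero_lt_iff.mpr ht0
  have hvq : v q = t ^ k := by rw [hq, map_pow]
  have hsq : ε ^ 2 = 1 := by rcases hε with h | h <;> rw [h] <;> norm_num
  have hesq : e₁ ^ 2 = 1 := by rcases he with h | h <;> rw [h] <;> norm_num
  have hvε : v ε = 1 := by
    rcases hε with h | h
    · rw [h, map_one]
    · rw [h, Valuation.map_neg, map_one]
  have hve : v e₁ = 1 := by
    rcases he with h | h
    · rw [h, map_one]
    · rw [h, Valuation.map_neg, map_one]
  have hunit : ∀ n : ℤ, ¬ (3 : ℤ) ∣ n → v (n : AlgebraicClosure ℚ) = 1 := fun n hn ↦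
    valuation_intCast_eq_one_of_not_dvd hn
  have h8v : v (8 : AlgebraicClosure ℚ) = 1 := by simpa using hunit 8 (by decide)
  have h24 : v (24 : AlgebraicClosure ℚ) = t := by
    rw [show (24 : AlgebraicClosure ℚ) = 8 * 3 by norm_num, map_mul, h8v, one_mul]
  have h1 : v (δ - 1) = 1 := by
    have e : δ - 1 = (δ + 8) - 9 := by ring
    have h9 : v (9 : AlgebraicClosure ℚ) < v (δ + 8) := by
      rw [h8, show (9 : AlgebraicClosure ℚ) = 3 ^ 2 by norm_num, map_pow]
      exact pow_lt_one₀ zero_le ht1 two_ne_zero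
    rw [e, valuation_sub_eq_of_lt h9, h8]
  -- `s`: `s³ = t^{3k+1}`, so `s < t^k`, `t^{k+1} < s`, `s < 1`, `s ≠ 0`
  have hs0 : s ≠ 0 := by
    intro h0; rw [h0, zero_pow three_ne_zero] at hδ; exact pow_ne_zero _ ht0 hδ.symm
  have hs0' : 0 < s := zero_lt_iff.mpr hs0
  have hstk : s < t ^ k := by
    refine lt_of_pow_lt_pow_left₀ 3 zero_le ?_
    rw [hδ, ← pow_mul]
    exact (pow_lt_pow_iff_of_lt_one' ht0 ht1).mpr (by omega)
  have htks : t ^ (k + 1) < s := by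
    refine lt_of_pow_lt_pow_left₀ 3 zero_le ?_
    rw [hδ, ← pow_mul]
    exact (pow_lt_pow_iff_of_lt_one' ht0 ht1).mpr (by omega)
  have hs1 : s < 1 := hstk.trans_le (pow_le_one₀ zero_le ht1.le)
  -- the identity
  set D := K - (ε - 3 * e₁) with hD
  have hid : (ε * q ^ 3 * (δ + 8) ^ 2 - 8 * K * (δ - 1) * (q + e₁ * δ) ^ 3) * (δ + 8) =
      -24 * e₁ * K * q ^ 2 * δ * (δ - 1) * (δ + 8) +
        (q ^ 3 * (ε * δ ^ 3) + q ^ 3 * ((24 * ε - 8 * K - 24 * e₁ * K ^ 2) * δ ^ 2) +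
          q ^ 3 * ((192 * ε - 56 * K + 48 * e₁ * K ^ 2) * δ) +
          q ^ 3 * (512 * ε + 64 * K - 24 * e₁ * K ^ 2) - 24 * K * q * δ ^ 2 * (δ - 1) * (δ + 8)) := by
    rcases he with h | h <;> subst h
    · linear_combination (-8 * K * (δ - 1)) * hR
    · linear_combination (8 * K * (δ - 1)) * hR
  -- the main term
  have hmain : v (-24 * e₁ * K * q ^ 2 * δ * (δ - 1) * (δ + 8)) = t ^ (2 * k + 1) * s := by
    simp only [map_mul, map_pow, Valuation.map_neg, h24, hve, hK, hvq, h1, h8, mul_one]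
    rw [← pow_mul, ← pow_succ', mul_comm k 2]
  -- bounds on the coefficients
  have hKle : v K ≤ 1 := hK.le
  have hc2 : v (24 * ε - 8 * K - 24 * e₁ * K ^ 2) ≤ 1 := by
    refine (Valuation.map_sub _ _ _).trans (max_le ((Valuation.map_sub _ _ _).trans (max_le ?_ ?_)) ?_)
    · rw [map_mul, h24, hvε, mul_one]; exact ht1.le
    · rw [map_mul, h8v, hK, mul_one]
    · rw [map_mul, map_mul, h24, hve, map_pow, hK, one_pow, mul_one, mul_one]; exact ht1.le
  have hc1 : v (192 * ε - 56 * K + 48 * e₁ * K ^ 2) ≤ 1 := by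
    refine (Valuation.map_add _ _ _).trans (max_le ((Valuation.map_sub _ _ _).trans (max_le ?_ ?_)) ?_)
    · rw [map_mul, hvε, mul_one, show (192 : AlgebraicClosure ℚ) = 64 * 3 by norm_num, map_mul,
        show (64 : AlgebraicClosure ℚ) = ((64 : ℤ) : AlgebraicClosure ℚ) by norm_num, hunit 64 (by decide),
        one_mul]; exact ht1.le
    · rw [map_mul, hK, mul_one, show (56 : AlgebraicClosure ℚ) = ((56 : ℤ) : AlgebraicClosure ℚ) by norm_num,
        hunit 56 (by decide)]
    · rw [map_mul, map_mul, hve, map_pow, hK, one_pow, mul_one, mul_one,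
        show (48 : AlgebraicClosure ℚ) = 16 * 3 by norm_num, map_mul,
        show (16 : AlgebraicClosure ℚ) = ((16 : ℤ) : AlgebraicClosure ℚ) by norm_num, hunit 16 (by decide),
        one_mul]; exact ht1.le
  have hc0 : v (512 * ε + 64 * K - 24 * e₁ * K ^ 2) ≤ t ^ 2 := by
    have e : 512 * ε + 64 * K - 24 * e₁ * K ^ 2 =
        3 ^ 2 * (80 * ε - 48 * e₁) + D * (208 - 48 * ε * e₁ - 24 * e₁ * D) := by
      rw [hD]; linear_combination (-24 * e₁) * hsq + (144 * K + 216 * e₁) * hesq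
    rw [e]
    have hD2 : v D ≤ t ^ 2 := hKε
    refine (Valuation.map_add _ _ _).trans (max_le ?_ ?_)
    · rw [map_mul, map_pow]
      calc t ^ 2 * v (80 * ε - 48 * e₁) ≤ t ^ 2 * 1 := by
            refine mul_le_mul' le_rfl ((Valuation.map_sub _ _ _).trans (max_le ?_ ?_))
            · rw [map_mul, hvε, mul_one, show (80 : AlgebraicClosure ℚ) = ((80 : ℤ) : AlgebraicClosure ℚ)
                by norm_num, hunit 80 (by decide)]
            · rw [map_mul, hve, mul_one, show (48 : AlgebraicClosure ℚ) = 16 * 3 by norm_num, map_mul,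
                show (16 : AlgebraicClosure ℚ) = ((16 : ℤ) : AlgebraicClosure ℚ) by norm_num,
                hunit 16 (by decide), one_mul]; exact ht1.le
        _ = t ^ 2 := mul_one _
    · rw [map_mul]
      calc v D * v (208 - 48 * ε * e₁ - 24 * e₁ * D) ≤ t ^ 2 * 1 := by
            refine mul_le_mul' hD2 ((Valuation.map_sub _ _ _).trans (max_le
              ((Valuation.map_sub _ _ _).trans (max_le ?_ ?_)) ?_))
            · rw [show (208 : AlgebraicClosure ℚ) = ((208 : ℤ) : AlgebraicClosure ℚ) by norm_num,
                hunit 208 (by decide)]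
            · rw [map_mul, map_mul, hvε, hve, mul_one, mul_one, show (48 : AlgebraicClosure ℚ) = 16 * 3
                by norm_num, map_mul, show (16 : AlgebraicClosure ℚ) = ((16 : ℤ) : AlgebraicClosure ℚ)
                by norm_num, hunit 16 (by decide), one_mul]; exact ht1.le
            · rw [map_mul, map_mul, h24, hve, mul_one]
              calc t * v D ≤ 1 * 1 := mul_le_mul' ht1.le (hD2.trans (pow_le_one₀ zero_le ht1.le))
                _ = 1 := mul_one _
        _ = t ^ 2 := mul_one _
  -- the five small terms
  have hq3 : v (q ^ 3) = t ^ (3 * k) := by rw [map_pow, hvq, ← pow_mul, mul_comm]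
  have h3k : t ^ (3 * k) ≤ t ^ (2 * k + 1) := pow_le_pow_right_of_le_one' ht1.le (by omega)
  have hT0 : 0 < t ^ (2 * k + 1) := pow_pos ht0' _
  have hr1 : v (q ^ 3 * (ε * δ ^ 3)) < t ^ (2 * k + 1) * s := by
    rw [map_mul, hq3, map_mul, hvε, one_mul, map_pow]
    have hs3 : s ^ 3 < s := by
      calc s ^ 3 = s ^ 2 * s := pow_succ s 2
        _ < 1 * s := mul_lt_mul_of_pos_right (pow_lt_one₀ zero_le hs1 two_ne_zero) hs0'
        _ = s := one_mul s
    calc t ^ (3 * k) * s ^ 3 ≤ t ^ (2 * k + 1) * s ^ 3 := mul_le_mul' h3k le_rfl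
      _ < t ^ (2 * k + 1) * s := mul_lt_mul_of_pos_left hs3 hT0
  have hr2 : v (q ^ 3 * ((24 * ε - 8 * K - 24 * e₁ * K ^ 2) * δ ^ 2)) < t ^ (2 * k + 1) * s := by
    rw [map_mul, hq3, map_mul, map_pow]
    have hs2 : s ^ 2 < s := by
      calc s ^ 2 = s * s := pow_two s
        _ < 1 * s := mul_lt_mul_of_pos_right hs1 hs0'
        _ = s := one_mul s
    calc t ^ (3 * k) * (v (24 * ε - 8 * K - 24 * e₁ * K ^ 2) * s ^ 2) ≤ t ^ (2 * k + 1) * (1 * s ^ 2) :=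
          mul_le_mul' h3k (mul_le_mul' hc2 le_rfl)
      _ = t ^ (2 * k + 1) * s ^ 2 := by rw [one_mul]
      _ < t ^ (2 * k + 1) * s := mul_lt_mul_of_pos_left hs2 hT0
  have hr3 : v (q ^ 3 * ((192 * ε - 56 * K + 48 * e₁ * K ^ 2) * δ)) < t ^ (2 * k + 1) * s := by
    rw [map_mul, hq3, map_mul]
    have hlt : t ^ (3 * k) < t ^ (2 * k + 1) := (pow_lt_pow_iff_of_lt_one' ht0 ht1).mpr (by omega)
    calc t ^ (3 * k) * (v (192 * ε - 56 * K + 48 * e₁ * K ^ 2) * s) ≤ t ^ (3 * k) * (1 * s) :=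
          mul_le_mul' le_rfl (mul_le_mul' hc1 le_rfl)
      _ = t ^ (3 * k) * s := by rw [one_mul]
      _ < t ^ (2 * k + 1) * s := mul_lt_mul_of_pos_right hlt hs0'
  have hr4 : v (q ^ 3 * (512 * ε + 64 * K - 24 * e₁ * K ^ 2)) < t ^ (2 * k + 1) * s := by
    rw [map_mul, hq3]
    calc t ^ (3 * k) * v (512 * ε + 64 * K - 24 * e₁ * K ^ 2) ≤ t ^ (3 * k) * t ^ 2 :=
          mul_le_mul' le_rfl hc0
      _ = t ^ (2 * k + 1) * t ^ (k + 1) := by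
          rw [← pow_add, ← pow_add]; congr 1; omega
      _ < t ^ (2 * k + 1) * s := mul_lt_mul_of_pos_left htks hT0
  have hr5 : v (24 * K * q * δ ^ 2 * (δ - 1) * (δ + 8)) < t ^ (2 * k + 1) * s := by
    rw [map_mul, map_mul, map_mul, map_mul, map_mul, h24, hK, mul_one, hvq, map_pow, h1, h8, mul_one,
      mul_one]
    calc t * t ^ k * s ^ 2 = t ^ (k + 1) * (s * s) := by rw [← pow_succ', pow_two]
      _ = t ^ (k + 1) * s * s := (mul_assoc _ _ _).symm
      _ < t ^ (k + 1) * t ^ k * s :=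
          mul_lt_mul_of_pos_right (mul_lt_mul_of_pos_left hstk (pow_pos ht0' _)) hs0'
      _ = t ^ (2 * k + 1) * s := by rw [← pow_add]; congr 2; omega
  have hrest : v (q ^ 3 * (ε * δ ^ 3) + q ^ 3 * ((24 * ε - 8 * K - 24 * e₁ * K ^ 2) * δ ^ 2) +
      q ^ 3 * ((192 * ε - 56 * K + 48 * e₁ * K ^ 2) * δ) +
      q ^ 3 * (512 * ε + 64 * K - 24 * e₁ * K ^ 2) - 24 * K * q * δ ^ 2 * (δ - 1) * (δ + 8)) <
      t ^ (2 * k + 1) * s := by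
    refine lt_of_le_of_lt (Valuation.map_sub _ _ _) (max_lt ?_ hr5)
    refine lt_of_le_of_lt (Valuation.map_add _ _ _) (max_lt ?_ hr4)
    refine lt_of_le_of_lt (Valuation.map_add _ _ _) (max_lt ?_ hr3)
    exact lt_of_le_of_lt (Valuation.map_add _ _ _) (max_lt hr1 hr2)
  have hsum := congrArg v hid
  rw [map_mul, h8, mul_one, Valuation.map_add_eq_of_lt_left _ (by rw [hmain]; exact hrest), hmain]
    at hsum
  exact hsum

/-! ### §2 Assembly: the invariant has valuation `4/9` -/

/-- **The level-`9` Hauptmodul at `v₃(j) = 3k + 4 ≥ 10`, `j/3^{v₃(j)} ≡ ε − 3e₁ (mod 9)` is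
valuation-forced after the unit normalisation.**  Let `k ≥ 2`, `ε, e₁ = ±1`, `j ∈ ℚ` with
`9 ∣ num(j/3^{3k+4} − (ε − 3e₁))`, and `S, θ ∈ ℚ̄` with `j(S − 27) = S(S − 24)³`, `v(S) = v(3)`,
`θ³ = S`.  Then **`v((3^{2k+2}θ/(2(θ³ − 24)(e₁(θ³ − 24) + 3^{k+1})))² − 1)⁹ = v(3)⁴`** —
`3`-adic valuation exactly `4/9`. [cite: Maier2006, Table 4 (N = 3, 9) and §5] -/
theorem valuation_hauptmodul_nine_invariant_vone_pow_nine {j : ℚ} {k : ℕ} (hk : 2 ≤ k) {ε e₁ : ℤ}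
    (hε : ε = 1 ∨ ε = -1) (he : e₁ = 1 ∨ e₁ = -1)
    (hj0 : (9 : ℤ) ∣ (j / 3 ^ (3 * k + 4) - ((ε - 3 * e₁ : ℤ) : ℚ)).num)
    {S θ : AlgebraicClosure ℚ}
    (hS : algebraMap ℚ (AlgebraicClosure ℚ) j * (S - 27) = S * (S - 24) ^ 3)
    (hvS : (placeOver 3).valuation S = (placeOver 3).valuation (3 : AlgebraicClosure ℚ))
    (hθ : θ ^ 3 = S) :
    (placeOver 3).valuation
        ((3 ^ (2 * k + 2) * θ / (2 * (θ ^ 3 - 24) * (e₁ * (θ ^ 3 - 24) + 3 ^ (k + 1)))) ^ 2 - 1) ^ 9 =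
      (placeOver 3).valuation (3 : AlgebraicClosure ℚ) ^ 4 := by
  set v := (placeOver 3).valuation with hv
  set t := v (3 : AlgebraicClosure ℚ) with ht
  have ht1 : t < 1 := valuation_three_lt_one
  have ht0 : t ≠ 0 := valuation_three_ne_zero
  have h3 : (3 : AlgebraicClosure ℚ) ≠ 0 := by norm_num
  have hc3 : ¬ (3 : ℤ) ∣ (ε - 3 * e₁) := by
    rcases hε with h | h <;> rcases he with h' | h' <;> rw [h, h'] <;> decide
  have hε' : (ε : AlgebraicClosure ℚ) = 1 ∨ (ε : AlgebraicClosure ℚ) = -1 := by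
    rcases hε with h | h
    · left; rw [h]; norm_num
    · right; rw [h]; norm_num
  have he' : (e₁ : AlgebraicClosure ℚ) = 1 ∨ (e₁ : AlgebraicClosure ℚ) = -1 := by
    rcases he with h | h
    · left; rw [h]; norm_num
    · right; rw [h]; norm_num
  have hε3' : (ε : AlgebraicClosure ℚ) ^ 3 = ε := by rcases hε' with h | h <;> rw [h] <;> norm_num
  have hve : v (e₁ : AlgebraicClosure ℚ) = 1 := by
    rcases he' with h | h
    · rw [h, map_one]
    · rw [h, Valuation.map_neg, map_one]
  -- `K = j/3^{3k+4} ≡ ε − 3e₁ (mod 9)`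
  obtain ⟨hKε, hK, hjK⟩ := valuation_facts_of_nine_dvd_num_sub (V := 3 * k + 4) hc3 hj0
  set K := algebraMap ℚ (AlgebraicClosure ℚ) (j / 3 ^ (3 * k + 4)) with hKdef
  simp only [Int.cast_sub, Int.cast_mul, Int.cast_ofNat] at hKε
  -- `S = 3(δ + 8)`, `q = 3^k`
  obtain ⟨δ, hSδ⟩ : ∃ δ : AlgebraicClosure ℚ, S = 3 * (δ + 8) := ⟨S / 3 - 8, by field_simp; ring⟩
  subst hSδ
  set q : AlgebraicClosure ℚ := (3 : AlgebraicClosure ℚ) ^ k with hq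
  have hR0 := delta_quartic_of_hauptmodul_three (n := 3 * k + 1) hjK hS rfl
  have hR : δ ^ 3 * (δ + 8) = 3 * q ^ 3 * K * (δ - 1) := by
    rw [hR0, hq]; ring
  have h8 : v (δ + 8) = 1 := by
    have e : t * v (δ + 8) = t * 1 := by rw [mul_one, ← map_mul]; exact hvS
    exact mul_left_cancel₀ ht0 e
  obtain ⟨h1, hδ3'⟩ := valuation_delta_of_quartic (n := 3 * k + 1) hK h8 hR0
  set s := v δ with hs
  have hδ3 : s ^ 3 = t ^ (3 * k + 1) := hδ3'
  have hs0 : s ≠ 0 := by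
    intro h0; rw [h0, zero_pow three_ne_zero] at hδ3; exact pow_ne_zero _ ht0 hδ3.symm
  have hδ0 : δ ≠ 0 := (Valuation.ne_zero_iff _).mp hs0
  have hvq : v q = t ^ k := by rw [hq, map_pow]
  have hq0 : q ≠ 0 := pow_ne_zero _ h3
  have hstk : s < t ^ k := by
    refine lt_of_pow_lt_pow_left₀ 3 zero_le ?_
    rw [hδ3, ← pow_mul]
    exact (pow_lt_pow_iff_of_lt_one' ht0 ht1).mpr (by omega)
  -- `v(q + e₁δ) = t^k`
  have hqd : v (q + e₁ * δ) = t ^ k := by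
    rw [Valuation.map_add_eq_of_lt_left _ (by rw [hvq, map_mul, hve, one_mul]; exact hstk), hvq]
  have hqd0 : q + e₁ * δ ≠ 0 := (Valuation.ne_zero_iff _).mp (by rw [hqd]; exact pow_ne_zero _ ht0)
  -- `Y = 3^{2k+2}θ/(2(θ³ − 24)(e₁(θ³ − 24) + 3^{k+1})) = q²θ/(2δ(q + e₁δ))`
  have hθδ : θ ^ 3 - 24 = 3 * δ := by rw [hθ]; ring
  have hden : (e₁ : AlgebraicClosure ℚ) * (θ ^ 3 - 24) + 3 ^ (k + 1) = 3 * (q + e₁ * δ) := by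
    rw [hθδ, hq]; ring
  set Y := 3 ^ (2 * k + 2) * θ / (2 * (θ ^ 3 - 24) * (e₁ * (θ ^ 3 - 24) + 3 ^ (k + 1))) with hYdef
  have hY : Y * (2 * δ * (q + e₁ * δ)) = q ^ 2 * θ := by
    have hne : 2 * (θ ^ 3 - 24) * ((e₁ : AlgebraicClosure ℚ) * (θ ^ 3 - 24) + 3 ^ (k + 1)) ≠ 0 := by
      rw [hden, hθδ]
      exact mul_ne_zero (mul_ne_zero two_ne_zero (mul_ne_zero h3 hδ0)) (mul_ne_zero h3 hqd0)
    have e : Y * (2 * (θ ^ 3 - 24) * ((e₁ : AlgebraicClosure ℚ) * (θ ^ 3 - 24) + 3 ^ (k + 1))) =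
        3 ^ (2 * k + 2) * θ := div_mul_cancel₀ _ hne
    rw [hden, hθδ, show ((3 : AlgebraicClosure ℚ) ^ (2 * k + 2)) = 9 * q ^ 2 by rw [hq]; ring] at e
    have e' : (9 : AlgebraicClosure ℚ) * (Y * (2 * δ * (q + e₁ * δ)) - q ^ 2 * θ) = 0 := by
      linear_combination e
    exact sub_eq_zero.mp ((mul_eq_zero.mp e').resolve_left (by norm_num))
  -- `(X³ − 1)·8δ³(q + e₁δ)³(δ + 8) = 3q³·N`
  have hX3 : (((ε : AlgebraicClosure ℚ) * Y) ^ 3 - 1) * (8 * δ ^ 3 * (q + e₁ * δ) ^ 3 * (δ + 8)) =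
      3 * q ^ 3 * (ε * q ^ 3 * (δ + 8) ^ 2 - 8 * K * (δ - 1) * (q + e₁ * δ) ^ 3) := by
    linear_combination ((ε : AlgebraicClosure ℚ) ^ 3 * (δ + 8) *
        ((Y * (2 * δ * (q + e₁ * δ))) ^ 2 + Y * (2 * δ * (q + e₁ * δ)) * (q ^ 2 * θ) + q ^ 4 * θ ^ 2)) * hY +
      ((ε : AlgebraicClosure ℚ) ^ 3 * q ^ 6 * (δ + 8)) * hθ + (3 * q ^ 6 * (δ + 8) ^ 2) * hε3' +
      (-8 * (q + e₁ * δ) ^ 3) * hR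
  have hN := valuation_numerator_vone hk hε' he' hKε hK h8 hR hδ3
  have h8v : v (8 : AlgebraicClosure ℚ) = 1 := by
    simpa using valuation_intCast_eq_one_of_not_dvd (n := 8) (by decide)
  have hq3 : v (q ^ 3) = t ^ (3 * k) := by rw [map_pow, hvq, ← pow_mul, mul_comm]
  have hval := congrArg v hX3
  rw [map_mul, map_mul, map_mul, map_mul, map_pow, h8v, one_mul, h8, mul_one, map_pow, hqd, hδ3,
    map_mul, map_mul, hq3, hN] at hval
  change v (((ε : AlgebraicClosure ℚ) * Y) ^ 3 - 1) * (t ^ (3 * k + 1) * (t ^ k) ^ 3) =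
    t * t ^ (3 * k) * (t ^ (2 * k + 1) * s) at hval
  -- `A · t^{3k} = t^{2k+1} s`, hence `A³ t^{9k} = t^{6k+3} s³ = t^{9k+4}`
  set A := v (((ε : AlgebraicClosure ℚ) * Y) ^ 3 - 1) with hA
  have hA1 : A * t ^ (3 * k) = t ^ (2 * k + 1) * s := by
    have e : A * t ^ (3 * k) * t ^ (3 * k + 1) = t ^ (2 * k + 1) * s * t ^ (3 * k + 1) := by
      calc A * t ^ (3 * k) * t ^ (3 * k + 1) = A * (t ^ (3 * k + 1) * (t ^ k) ^ 3) := by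
            rw [← pow_mul, mul_comm k 3, mul_assoc, mul_comm (t ^ (3 * k))]
        _ = t * t ^ (3 * k) * (t ^ (2 * k + 1) * s) := hval
        _ = t ^ (2 * k + 1) * s * t ^ (3 * k + 1) := by rw [← pow_succ', mul_comm]
    exact mul_right_cancel₀ (pow_ne_zero _ ht0) e
  have hcube : A ^ 3 = t ^ 4 := by
    have e : A ^ 3 * t ^ (9 * k) = t ^ 4 * t ^ (9 * k) := by
      calc A ^ 3 * t ^ (9 * k) = (A * t ^ (3 * k)) ^ 3 := by rw [mul_pow, ← pow_mul]; congr 2; omega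
        _ = (t ^ (2 * k + 1) * s) ^ 3 := by rw [hA1]
        _ = t ^ (3 * (2 * k + 1)) * s ^ 3 := by rw [mul_pow, ← pow_mul, mul_comm (2 * k + 1)]
        _ = t ^ 4 * t ^ (9 * k) := by rw [hδ3, ← pow_add, ← pow_add]; congr 1; omega
    exact mul_right_cancel₀ (pow_ne_zero _ ht0) e
  exact valuation_sq_sub_one_pow_nine_of_cube_pow_four hε' hcube

end Summit.BirchSwinnertonDyer.Rank1Residual.GaloisImage
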